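import Literature.NumberTheory.Automorphic.MaximalOrderRamifiedPrime
import Literature.NumberTheory.Automorphic.BrandtModuleResidue
import Literature.NumberTheory.Automorphic.BrandtModuleWeightSymmProofs
import Literature.NumberTheory.Automorphic.BrandtWeightSymmetry
import HarnessLib

/-!
# The prime ideal above a ramified prime: `P = {x ∈ O : p ∣ nrd x}`, `[O : P] = p²`,
# `P_(p) = u O_(p)`, `(P P)_(p) = p O_(p)` (Vignéras, LNM 800, Ch. II §1 Lemme 1.5, Cor. 1.7)

Topic `NumberTheory/Automorphic`; one definition (`normPrimeIdeal O p`, the `ℤ`-span of the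
elements of `O` whose reduced norm is divisible by `p`), otherwise theorems. Let `B` be a
quaternion algebra over `ℚ`, `p` a prime with `ℚ_p ⊗ B` a division algebra (i.e. `p` ramified),
and `O` a `ℤ`-order of `B` which is *maximal at `p`*, i.e. `O_(p) = {x : nrd x, trd x ∈ ℤ_(p)}`
(every maximal order, `IsMaximalZOrder.mem_localAt_iff_of_padic_division`, and every Eichler
order, `MaximalOrderRamifiedPrime.lean`). Vignéras II §1: the valuation ring `O_p` of `B_p` has
the unique maximal (two-sided) ideal `P = {h : w(h) > 0} = O_p u` for a uniformiser `u`, with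
`P² = O_p p` and residue field of order `p²` (Cor. 1.7: `e = f = 2`), and all its integral
ideals are powers of `P` (Lemme 1.5). We prove the corresponding statements for the global
lattice `P = normPrimeIdeal O p` and its localisation `P_(p) = localAt p P`:

**The ideal.**
* `mem_normPrimeIdeal_iff` — **`P = {x ∈ O : p ∣ nrd x}`** is already a `ℤ`-submodule: closed
  under addition because `trd(x ȳ) ∈ p ℤ` when `p ∣ nrd x`, `p ∣ nrd y` (the element `x ȳ / p`
  has integral norm, hence integral trace — Lemme 1.4, `QuaternionPadicIntegralTrace.lean`);
* `P` is a **two-sided `O`-ideal** containing `p O` and not `1`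
  (`mul_mem_normPrimeIdeal_left/right`, `smul_le_normPrimeIdeal`, `one_not_mem_normPrimeIdeal`);
* for `O` maximal at `p`: **`{x ∈ O : p² ∣ nrd x} = p O`** (`mem_smul_of_sq_dvd_reducedNorm`),
  hence **`P · P ⊆ p O`** (`mul_mem_smul_of_mem_normPrimeIdeal`) and **`trd(P) ⊆ p ℤ`**
  (`exists_reducedTrace_eq_mul_of_mem_normPrimeIdeal`).

**The index `[O : P] = p²`**, by index counting, the only further input being the isotropy of
the norm form modulo `p` (`IsZOrder.exists_nrdZ_dvd_not_mem`, Chevalley–Warning,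
`BrandtModuleResidue.lean`):
1. there is a *uniformiser* `u ∈ O ∖ p O` with `p ∣ nrd u` (`exists_uniformiser`); then
   `nrd u = p n` with `p ∤ n`, and `Q = u O + p O ⊆ P`;
2. `[O : Q]` divides both `[O : u O] = p² n²` and `[O : p O] = p⁴`, hence divides `p²`
   (`relIndex_span_uniformiser_dvd`); in particular `[O : P] ∣ p²`;
3. left multiplication by `u` maps `O` onto `u O` and `P` into `P² ⊆ p O`, so
   `[O : P] ≥ [O : {x ∈ O : u x ∈ p O}] = [u O : u O ∩ p O] = [Q : p O] = p⁴ / [O : Q] ≥ p²`;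
4. therefore **`[O : P] = p²`** (`relIndex_normPrimeIdeal`) and **`P = u O + p O`**
   (`normPrimeIdeal_eq_sup`).

**Locally at `p`.**
* `mem_localAt_normPrimeIdeal_iff` — `x ∈ P_(p) ↔ x ∈ O_(p) ∧ nrd x ∈ p ℤ_(p)`;
  `inv_mem_localAt_of_dvd_den` — elements of `O_(p)` of `p`-unit norm are units of `O_(p)`
  (`O_(p)` is local with maximal ideal `P_(p)`);
* `localAt_normPrimeIdeal_eq_units_smul` — **`P_(p) = u O_(p)`** (`P = O u`);
  `natCast_mem_localAt_normPrimeIdeal_mul`, `localAt_normPrimeIdeal_mul` —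
  **`(P P)_(p) = p O_(p)`** (`P² = O p`); `relIndex_localAt_normPrimeIdeal` — `[O_(p) : P_(p)] = p²`;
* `eq_localAt_normPrimeIdeal_of_relIndex_eq_sq` — **uniqueness**: a right `O_(p)`-stable
  submodule `N ⊆ O_(p)` of index `p²` is `P_(p)` (the integral ideal of norm `p` is `P`).

These are the local inputs for the Brandt matrix `B(p)` at `p ∣ disc B`
(`BrandtMatrixRamified.lean`).

## References

* M.-F. Vignéras, *Arithmétique des algèbres de quaternions*, LNM 800 (1980), Ch. II §1
  Lemme 1.4, Lemme 1.5, Cor. 1.7 (pp. 32–33) [VignerasLNM800].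
* J. Voight, *Quaternion Algebras*, GTM 288 (2021), §13.3 (Thm. 13.3.11) [Voight2021].
-/

noncomputable section

open scoped Pointwise

universe u

namespace Literature.NumberTheory.Automorphic

/-! ## Part I. The ideal `P` -/

section Ideal

variable {B : Type u} [Ring B] [Algebra ℚ B]

/-- The **prime ideal of `O` above `p`** (meaningful at a ramified prime `p` of a quaternion
algebra over `ℚ`): the `ℤ`-span of `{x ∈ O : p ∣ nrd x}` — which is that set itself as soon as
`ℚ_p ⊗ B` is a division algebra (`mem_normPrimeIdeal_iff`). Vignéras II §1: the maximal ideal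
`P = {h ∈ O_p : w(h) > 0}` of the valuation ring. [cite: VignerasLNM800, Ch. II §1 Lemme 1.5] -/
def normPrimeIdeal (O : Submodule ℤ B) (p : ℕ) : Submodule ℤ B :=
  Submodule.span ℤ {x | x ∈ O ∧ ∃ n : ℤ, reducedNorm ℚ B x = p * n}

/-- Elements of `O` with `p ∣ nrd x` lie in `normPrimeIdeal O p`. [folklore] -/
theorem mem_normPrimeIdeal_of_mem {O : Submodule ℤ B} {p : ℕ} {x : B} (hx : x ∈ O)
    (hn : ∃ n : ℤ, reducedNorm ℚ B x = p * n) : x ∈ normPrimeIdeal O p :=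
  Submodule.subset_span ⟨hx, hn⟩

/-- `normPrimeIdeal O p ⊆ O`. [folklore] -/
theorem normPrimeIdeal_le (O : Submodule ℤ B) (p : ℕ) : normPrimeIdeal O p ≤ O :=
  Submodule.span_le.mpr fun _ hx => hx.1

section Arithmetic

variable {p : ℕ} [hp : Fact p.Prime]

/-- If `T / p` is `p`-integral for an integer `T`, then `p ∣ T`. [folklore] -/
theorem Int.dvd_of_not_dvd_den_div {T : ℤ} (h : ¬ p ∣ ((T : ℚ) / p).den) : (p : ℤ) ∣ T := by
  set q : ℚ := (T : ℚ) / p with hq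
  have hpQ : (p : ℚ) ≠ 0 := by exact_mod_cast hp.out.ne_zero
  have h1 : (T : ℚ) * q.den = q.num * p := by
    have := Rat.mul_den_eq_num q
    rw [hq] at this ⊢
    field_simp at this
    linear_combination this
  have h2 : T * (q.den : ℤ) = q.num * p := by exact_mod_cast h1
  have h3 : (p : ℤ) ∣ T * q.den := ⟨q.num, by rw [h2, mul_comm]⟩
  rcases (Int.prime_iff_natAbs_prime.mpr (by simpa using hp.out)).dvd_or_dvd h3 with h4 | h4
  · exact h4
  · exact absurd (Int.natCast_dvd_natCast.mp h4) h

end Arithmetic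

section Division

variable [IsQuaternionAlgebra ℚ B] {O : Submodule ℤ B} {p : ℕ} [hp : Fact p.Prime]

variable (hdivp : ∀ X : ScalarExtension ℚ ℚ_[p] B, X ≠ 0 → IsUnit X)
include hdivp

/-- **The polar form is divisible by `p` on elements of norm divisible by `p`** (ramified `p`):
if `x, y ∈ O` with `p ∣ nrd x`, `p ∣ nrd y` then `p ∣ trd(x ȳ)` — the element `x ȳ / p` has
integral reduced norm `(nrd x / p)(nrd y / p)`, hence `p`-integral reduced trace (Vignéras II §1
Lemme 1.4). [cite: VignerasLNM800, Ch. II §1 Lemme 1.4] -/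
theorem exists_reducedTrace_mul_standardInvolution_eq_mul (hO : IsZOrder O) {x y : B} (hx : x ∈ O)
    (hy : y ∈ O) (hnx : ∃ n : ℤ, reducedNorm ℚ B x = p * n) (hny : ∃ n : ℤ, reducedNorm ℚ B y = p * n) :
    ∃ t : ℤ, reducedTrace ℚ B (x * standardInvolution ℚ B y) = p * t := by
  obtain ⟨n, hn⟩ := hnx
  obtain ⟨m, hm⟩ := hny
  have hpQ : (p : ℚ) ≠ 0 := by exact_mod_cast hp.out.ne_zero
  set z : B := x * standardInvolution ℚ B y with hz
  have hzO : z ∈ O := hO.mul_mem _ hx _ (hO.toIsOrder.standardInvolution_mem hy)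
  obtain ⟨T, -, hT, -⟩ := hO.toIsOrder.exists_int_reducedTrace_reducedNorm hzO
  -- `z / p` has integral norm `n m`
  have hnorm : reducedNorm ℚ B ((p : ℚ)⁻¹ • z) = n * m := by
    rw [reducedNorm_smul, hz, reducedNorm_mul_holds ℚ B, reducedNorm_standardInvolution, hn, hm]
    field_simp
  have hint : ¬ p ∣ (reducedNorm ℚ B ((p : ℚ)⁻¹ • z)).den := by
    rw [hnorm, ← Int.cast_mul]
    exact not_dvd_den_intCast hp.out _
  have htr := not_dvd_den_reducedTrace_of_not_dvd_den_reducedNorm hdivp hint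
  rw [map_smul, hT, smul_eq_mul, inv_mul_eq_div] at htr
  obtain ⟨k, hk⟩ := Int.dvd_of_not_dvd_den_div htr
  exact ⟨k, by rw [hT, hk]; push_cast; ring⟩

/-- **`{x ∈ O : p ∣ nrd x}` is closed under addition** at a ramified prime:
`nrd(x + y) = nrd x + nrd y + trd(x ȳ)`. [cite: VignerasLNM800, Ch. II §1 Lemme 1.4] -/
theorem exists_reducedNorm_add_eq_mul (hO : IsZOrder O) {x y : B} (hx : x ∈ O) (hy : y ∈ O)
    (hnx : ∃ n : ℤ, reducedNorm ℚ B x = p * n) (hny : ∃ n : ℤ, reducedNorm ℚ B y = p * n) :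
    ∃ n : ℤ, reducedNorm ℚ B (x + y) = p * n := by
  obtain ⟨t, ht⟩ := exists_reducedTrace_mul_standardInvolution_eq_mul hdivp hO hx hy hnx hny
  obtain ⟨n, hn⟩ := hnx
  obtain ⟨m, hm⟩ := hny
  exact ⟨n + m + t, by rw [reducedNorm_add, hn, hm, ht]; push_cast; ring⟩

/-- **`normPrimeIdeal O p = {x ∈ O : p ∣ nrd x}`** at a ramified prime: the generating set is
already a `ℤ`-submodule. [cite: VignerasLNM800, Ch. II §1 Lemme 1.5] -/
theorem mem_normPrimeIdeal_iff (hO : IsZOrder O) {x : B} :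
    x ∈ normPrimeIdeal O p ↔ x ∈ O ∧ ∃ n : ℤ, reducedNorm ℚ B x = p * n := by
  let S : Submodule ℤ B :=
    { carrier := {x | x ∈ O ∧ ∃ n : ℤ, reducedNorm ℚ B x = p * n}
      add_mem' := fun {a b} ha hb => ⟨O.add_mem ha.1 hb.1,
        exists_reducedNorm_add_eq_mul hdivp hO ha.1 hb.1 ha.2 hb.2⟩
      zero_mem' := ⟨O.zero_mem, 0, by rw [reducedNorm_apply_zero]; simp⟩
      smul_mem' := fun c {y} hy => ⟨O.smul_mem c hy.1, by
        obtain ⟨n, hn⟩ := hy.2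
        exact ⟨c ^ 2 * n, by rw [reducedNorm_zsmul, hn]; push_cast; ring⟩⟩ }
  change x ∈ Submodule.span ℤ (S : Set B) ↔ x ∈ (S : Set B)
  rw [Submodule.span_eq]
  rfl

omit hp hdivp in
/-- `O · P ⊆ P`: left multiples by `O` stay in the prime ideal (multiplicativity of `nrd`). [folklore] -/
theorem mul_mem_normPrimeIdeal_left (hO : IsZOrder O) {a x : B} (ha : a ∈ O)
    (hx : x ∈ normPrimeIdeal O p) : a * x ∈ normPrimeIdeal O p := by
  refine Submodule.span_induction (p := fun y _ => a * y ∈ normPrimeIdeal O p) ?_ ?_ ?_ ?_ hx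
  · rintro y ⟨hy, n, hn⟩
    obtain ⟨N, hN⟩ := hO.exists_int_reducedNorm ha
    exact mem_normPrimeIdeal_of_mem (hO.mul_mem _ ha _ hy)
      ⟨N * n, by rw [reducedNorm_mul_holds ℚ B, hN, hn]; push_cast; ring⟩
  · rw [mul_zero]; exact Submodule.zero_mem _
  · intro y z _ _ hy hz; rw [mul_add]; exact add_mem hy hz
  · intro c y _ hy; rw [mul_smul_comm]; exact Submodule.smul_mem _ c hy

omit hp hdivp in
/-- `P · O ⊆ P`: right multiples by `O` stay in the prime ideal. [folklore] -/
theorem mul_mem_normPrimeIdeal_right (hO : IsZOrder O) {a x : B} (ha : a ∈ O)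
    (hx : x ∈ normPrimeIdeal O p) : x * a ∈ normPrimeIdeal O p := by
  refine Submodule.span_induction (p := fun y _ => y * a ∈ normPrimeIdeal O p) ?_ ?_ ?_ ?_ hx
  · rintro y ⟨hy, n, hn⟩
    obtain ⟨N, hN⟩ := hO.exists_int_reducedNorm ha
    exact mem_normPrimeIdeal_of_mem (hO.mul_mem _ hy _ ha)
      ⟨n * N, by rw [reducedNorm_mul_holds ℚ B, hN, hn]; push_cast; ring⟩
  · rw [zero_mul]; exact Submodule.zero_mem _
  · intro y z _ _ hy hz; rw [add_mul]; exact add_mem hy hz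
  · intro c y _ hy; rw [smul_mul_assoc]; exact Submodule.smul_mem _ c hy

omit hp hdivp in
/-- `p O ⊆ P` (`nrd(p y) = p² nrd y`). [folklore] -/
theorem smul_le_normPrimeIdeal (hO : IsZOrder O) : (p : ℤ) • O ≤ normPrimeIdeal O p := by
  intro z hz
  obtain ⟨y, hy, rfl⟩ := (Submodule.mem_smul_pointwise_iff_exists z _ O).mp hz
  obtain ⟨N, hN⟩ := hO.exists_int_reducedNorm hy
  exact mem_normPrimeIdeal_of_mem (O.smul_mem _ hy)
    ⟨p * N, by rw [reducedNorm_zsmul, hN]; push_cast; ring⟩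

/-- `1 ∉ P` (`nrd 1 = 1` is not divisible by `p`); so `P ≠ O`. [folklore] -/
theorem one_not_mem_normPrimeIdeal (hO : IsZOrder O) : (1 : B) ∉ normPrimeIdeal O p := by
  rw [mem_normPrimeIdeal_iff hdivp hO]
  rintro ⟨-, n, hn⟩
  rw [reducedNorm_one ℚ B] at hn
  have h : (1 : ℤ) = p * n := by exact_mod_cast hn
  have : (p : ℤ) ∣ 1 := ⟨n, h⟩
  exact hp.out.one_lt.ne' (by exact_mod_cast Int.eq_one_of_dvd_one (Int.natCast_nonneg p) this)

/-- `P ≠ O`. [folklore] -/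
theorem normPrimeIdeal_ne (hO : IsZOrder O) : normPrimeIdeal O p ≠ O := fun h =>
  one_not_mem_normPrimeIdeal hdivp hO (by rw [h]; exact hO.one_mem)

end Division

/-! ### Orders maximal at `p`: `{p² ∣ nrd} = p O`, `P² ⊆ p O`, `trd(P) ⊆ p ℤ` -/

section MaximalAtP

variable [IsQuaternionAlgebra ℚ B] {O : Submodule ℤ B} {p : ℕ} [hp : Fact p.Prime]
variable (hdivp : ∀ X : ScalarExtension ℚ ℚ_[p] B, X ≠ 0 → IsUnit X)
variable (hOp : ∀ x : B, x ∈ localAt p O ↔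
  ¬ p ∣ (reducedNorm ℚ B x).den ∧ ¬ p ∣ (reducedTrace ℚ B x).den)
include hdivp hOp

/-- **`{x ∈ O : p² ∣ nrd x} = p O`** for an order maximal at the ramified prime `p`: `x / p` has
`p`-integral norm, hence lies in `O_(p)`, and `p · (x/p) = x ∈ O` together with `m · (x/p) ∈ O`,
`p ∤ m`, gives `x / p ∈ O` (Bézout). (Vignéras II §1: `w(h) ≥ 2 ⇒ h ∈ O_p p`.) [cite: VignerasLNM800, Ch. II §1 Lemme 1.5 and Cor. 1.7] -/
theorem mem_smul_of_sq_dvd_reducedNorm {x : B} (hx : x ∈ O)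
    (hn : ∃ n : ℤ, reducedNorm ℚ B x = (p : ℚ) ^ 2 * n) : x ∈ (p : ℤ) • O := by
  obtain ⟨n, hn⟩ := hn
  have hpQ : (p : ℚ) ≠ 0 := by exact_mod_cast hp.out.ne_zero
  set x' : B := (p : ℚ)⁻¹ • x with hx'
  have hnorm : reducedNorm ℚ B x' = n := by
    rw [hx', reducedNorm_smul, hn]; field_simp
  have hx'p : x' ∈ localAt p O := by
    refine (hOp x').mpr ⟨?_, not_dvd_den_reducedTrace_of_not_dvd_den_reducedNorm hdivp ?_⟩ <;>
    · rw [hnorm]; exact not_dvd_den_intCast hp.out n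
  obtain ⟨m, hm0, hm, hmx'⟩ := hx'p
  have hpx' : (p : ℤ) • x' = x := by
    rw [hx', ← Int.cast_smul_eq_zsmul ℚ, smul_smul, Int.cast_natCast, mul_inv_cancel₀ hpQ, one_smul]
  -- Bézout: `x' = a (m x') + b (p x') ∈ O`
  obtain ⟨a, b, hab⟩ := Nat.isCoprime_iff_coprime.mpr hm
  have hx'O : x' ∈ O := by
    have : x' = a • ((m : ℤ) • x') + b • ((p : ℤ) • x') := by
      rw [smul_smul, smul_smul, ← add_smul, hab, one_smul]
    rw [this]
    exact O.add_mem (O.smul_mem a hmx') (O.smul_mem b (hpx' ▸ hx))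
  rw [← hpx']
  exact Submodule.smul_mem_pointwise_smul x' _ O hx'O

/-- **`P · P ⊆ p O`**: the product of two elements of `O` of norm divisible by `p` lies in `p O`
(its norm is divisible by `p²`). (Vignéras II §1 Cor. 1.7: `P² = O p`.) [cite: VignerasLNM800, Ch. II §1 Cor. 1.7] -/
theorem mul_mem_smul_of_mem_normPrimeIdeal (hO : IsZOrder O) {x y : B}
    (hx : x ∈ normPrimeIdeal O p) (hy : y ∈ normPrimeIdeal O p) : x * y ∈ (p : ℤ) • O := by
  rw [mem_normPrimeIdeal_iff hdivp hO] at hx hy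
  obtain ⟨hxO, n, hn⟩ := hx
  obtain ⟨hyO, m, hm⟩ := hy
  exact mem_smul_of_sq_dvd_reducedNorm hdivp hOp (hO.mul_mem _ hxO _ hyO)
    ⟨n * m, by rw [reducedNorm_mul_holds ℚ B, hn, hm]; push_cast; ring⟩

/-- `P * P ≤ p O` as lattices. [cite: VignerasLNM800, Ch. II §1 Cor. 1.7] -/
theorem normPrimeIdeal_mul_le (hO : IsZOrder O) :
    normPrimeIdeal O p * normPrimeIdeal O p ≤ (p : ℤ) • O :=
  Submodule.mul_le.mpr fun _ hx _ hy => mul_mem_smul_of_mem_normPrimeIdeal hdivp hOp hO hx hy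

/-- **`trd(P) ⊆ p ℤ`**: an element of `O` of norm divisible by `p` has trace divisible by `p`
(from `x² = trd(x) x - nrd(x) ∈ p O`: either `p ∣ trd x`, or `x ∈ p O` and again `p ∣ trd x`). [cite: VignerasLNM800, Ch. II §1 Cor. 1.7] -/
theorem exists_reducedTrace_eq_mul_of_mem_normPrimeIdeal (hO : IsZOrder O) {x : B}
    (hx : x ∈ normPrimeIdeal O p) : ∃ t : ℤ, reducedTrace ℚ B x = p * t := by
  haveI : IsAddTorsionFree B := isAddTorsionFree_of_charZero_module ℚ B
  have hxx := mul_mem_smul_of_mem_normPrimeIdeal hdivp hOp hO hx hx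
  rw [mem_normPrimeIdeal_iff hdivp hO] at hx
  obtain ⟨hxO, n, hn⟩ := hx
  obtain ⟨T, N, hT, hN⟩ := hO.toIsOrder.exists_int_reducedTrace_reducedNorm hxO
  -- `T • x = x² + nrd(x) • 1 ∈ p O`
  have hTx : T • x ∈ (p : ℤ) • O := by
    have h := mul_self_eq_smul_sub ℚ x
    rw [hT, hN, Int.cast_smul_eq_zsmul] at h
    have : T • x = x * x + algebraMap ℚ B (N : ℚ) := by rw [h]; abel
    have hNpn : (N : ℚ) = (p : ℚ) * n := by rw [← hN, hn]
    rw [this, hNpn, map_mul, map_natCast, map_intCast]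
    refine add_mem hxx ?_
    rw [show ((p : B) * (n : B) : B) = (p : ℤ) • ((n : ℤ) • (1 : B)) by simp [zsmul_eq_mul]]
    exact Submodule.smul_mem_pointwise_smul _ _ O (O.smul_mem _ hO.one_mem)
  by_cases hpT : (p : ℤ) ∣ T
  · obtain ⟨t, ht⟩ := hpT
    exact ⟨t, by rw [hT, ht]; push_cast; ring⟩
  · -- `p ∤ T`: Bézout puts `x` itself in `p O`, and then `trd x = p trd(x/p)`
    have hcop : IsCoprime T (p : ℤ) := by
      rw [Int.isCoprime_iff_gcd_eq_one]
      have hg := Int.gcd_dvd_right T p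
      rcases (Nat.dvd_prime hp.out).mp (by exact_mod_cast hg : Int.gcd T p ∣ p) with h1 | h2
      · exact h1
      · exfalso; apply hpT
        have := Int.gcd_dvd_left T p
        rw [h2] at this
        exact this
    obtain ⟨a, b, hab⟩ := hcop
    have hxp : x ∈ (p : ℤ) • O := by
      have : x = a • (T • x) + b • ((p : ℤ) • x) := by
        rw [smul_smul, smul_smul, ← add_smul, hab, one_smul]
      rw [this]
      exact add_mem (Submodule.smul_mem _ a hTx)
        (Submodule.smul_mem _ b (Submodule.smul_mem_pointwise_smul x _ O hxO))
    obtain ⟨y, hy, hyx⟩ := (Submodule.mem_smul_pointwise_iff_exists x _ O).mp hxp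
    obtain ⟨t, -, ht, -⟩ := hO.toIsOrder.exists_int_reducedTrace_reducedNorm hy
    exact ⟨t, by rw [← hyx, map_zsmul, ht, zsmul_eq_mul]; push_cast; ring⟩

/-- `trd(x y) ∈ p ℤ` for `x, y ∈ P` (indeed `x y ∈ p O`). [folklore] -/
theorem exists_reducedTrace_mul_eq_mul_of_mem_normPrimeIdeal (hO : IsZOrder O) {x y : B}
    (hx : x ∈ normPrimeIdeal O p) (hy : y ∈ normPrimeIdeal O p) :
    ∃ t : ℤ, reducedTrace ℚ B (x * y) = p * t := by
  obtain ⟨z, hz, hzxy⟩ := (Submodule.mem_smul_pointwise_iff_exists _ _ O).mp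
    (mul_mem_smul_of_mem_normPrimeIdeal hdivp hOp hO hx hy)
  obtain ⟨t, -, ht, -⟩ := hO.toIsOrder.exists_int_reducedTrace_reducedNorm hz
  exact ⟨t, by rw [← hzxy, map_zsmul, ht, zsmul_eq_mul]; push_cast; ring⟩

end MaximalAtP

/-! ### Maximal orders and Eichler orders are maximal at the ramified primes -/

section Instances

variable [IsQuaternionAlgebra ℚ B] {p : ℕ} [hp : Fact p.Prime]

/-- A maximal order is maximal at `p` (restating `IsMaximalZOrder.mem_localAt_iff_of_padic_division`
in the shape of the hypothesis `hOp` of this file). [cite: VignerasLNM800, Ch. II §1 Lemme 1.5] -/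
theorem IsMaximalZOrder.maximalAtP {O : Submodule ℤ B} (hO : IsMaximalZOrder O)
    (hdivp : ∀ X : ScalarExtension ℚ ℚ_[p] B, X ≠ 0 → IsUnit X) :
    ∀ x : B, x ∈ localAt p O ↔
      ¬ p ∣ (reducedNorm ℚ B x).den ∧ ¬ p ∣ (reducedTrace ℚ B x).den :=
  hO.mem_localAt_iff_of_padic_division hdivp

/-- An intersection of two maximal orders (an Eichler order) is maximal at a ramified `p`. [cite: VignerasLNM800, Ch. III §5 (ordres d'Eichler, propriétés locales)] -/
theorem maximalAtP_inf {O₁ O₂ : Submodule ℤ B} (hO₁ : IsMaximalZOrder O₁) (hO₂ : IsMaximalZOrder O₂)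
    (hdivp : ∀ X : ScalarExtension ℚ ℚ_[p] B, X ≠ 0 → IsUnit X) :
    ∀ x : B, x ∈ localAt p (O₁ ⊓ O₂) ↔
      ¬ p ∣ (reducedNorm ℚ B x).den ∧ ¬ p ∣ (reducedTrace ℚ B x).den := fun x => by
  rw [localAt_inf_eq_of_padic_division hO₁ hO₂ hdivp]
  exact hO₁.mem_localAt_iff_of_padic_division hdivp x

end Instances

end Ideal

/-! ## Part II. The index `[O : P] = p²` -/

section IndexPart

variable {B : Type u} [Ring B] [Algebra ℚ B] [IsQuaternionAlgebra ℚ B]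
variable {O : Submodule ℤ B} {p : ℕ} [hp : Fact p.Prime]

/-! ### Index bookkeeping -/

section Index

omit [Algebra ℚ B] [IsQuaternionAlgebra ℚ B] hp in
/-- Translation by a unit distributes over intersections of lattices. [folklore] -/
theorem units_smul_inf (b : Bˣ) (M N : Submodule ℤ B) : b • (M ⊓ N) = b • M ⊓ b • N := by
  ext x
  simp only [Submodule.mem_inf, mem_units_smul_submodule_iff]

omit [IsQuaternionAlgebra ℚ B] hp in
/-- `[O : p O] = p⁴` for a full lattice `O` (as a translate by the central unit `p · 1`). [folklore] -/
theorem relIndex_natCast_smul_eq_pow_four [IsQuaternionAlgebra ℚ B] (hO : IsFullLattice B O)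
    (hp0 : p ≠ 0) : (((p : ℤ) • O).toAddSubgroup).relIndex O.toAddSubgroup = p ^ 4 := by
  obtain ⟨ν, hν, -⟩ := Brandt.exists_units_val_eq_natCast (D := B) hp0
  have h : (p : ℤ) • O = ν • O := by
    ext x
    constructor
    · intro hx
      obtain ⟨y, hy, rfl⟩ := (Submodule.mem_smul_pointwise_iff_exists x _ O).mp hx
      exact Brandt.units_smul_eq_zsmul_of_val_eq hν O hy
    · intro hx
      obtain ⟨y, hy, rfl⟩ := Brandt.exists_eq_zsmul_of_mem_units_smul hν hx
      exact Submodule.smul_mem_pointwise_smul y _ O hy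
  rw [h]
  exact Brandt.relIndex_natCast_smul hO hν

end Index

/-! ### The uniformiser and the index `[O : P] = p²` -/

section Uniformiser

variable (hdivp : ∀ X : ScalarExtension ℚ ℚ_[p] B, X ≠ 0 → IsUnit X)
variable (hOp : ∀ x : B, x ∈ localAt p O ↔
  ¬ p ∣ (reducedNorm ℚ B x).den ∧ ¬ p ∣ (reducedTrace ℚ B x).den)
include hdivp

/-- **A uniformiser exists**: there is a unit `u` of `B` in `O ∖ p O` with `p ∣ nrd u`, i.e.
`u ∈ P ∖ p O` (isotropy of the norm form modulo `p`, `IsZOrder.exists_nrdZ_dvd_not_mem`). [cite: VignerasLNM800, Ch. II §1 Cor. 1.7] -/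
theorem exists_uniformiser (hO : IsZOrder O) :
    ∃ u : Bˣ, (u : B) ∈ normPrimeIdeal O p ∧ (u : B) ∉ (p : ℤ) • O := by
  obtain ⟨x, hxO, hxp, hdvd⟩ := hO.exists_nrdZ_dvd_not_mem hp.out
  have hx0 : x ≠ 0 := fun h => hxp (by rw [h]; exact Submodule.zero_mem _)
  refine ⟨(forall_isUnit_of_padic_division hdivp x hx0).unit, ?_, hxp⟩
  rw [IsUnit.unit_spec]
  obtain ⟨n, hn⟩ := hdvd
  refine mem_normPrimeIdeal_of_mem hxO ⟨n, ?_⟩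
  rw [← hO.cast_nrdZ hxO, hn]; push_cast; ring

include hOp

/-- The reduced norm of a uniformiser is `p n` with `p ∤ n` (else `u ∈ p O`, by
`mem_smul_of_sq_dvd_reducedNorm`). [cite: VignerasLNM800, Ch. II §1 Cor. 1.7] -/
theorem exists_reducedNorm_uniformiser (hO : IsZOrder O) {u : Bˣ} (hu : (u : B) ∈ normPrimeIdeal O p)
    (hup : (u : B) ∉ (p : ℤ) • O) :
    ∃ n : ℤ, reducedNorm ℚ B (u : B) = p * n ∧ ¬ (p : ℤ) ∣ n := by
  rw [mem_normPrimeIdeal_iff hdivp hO] at hu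
  obtain ⟨huO, n, hn⟩ := hu
  refine ⟨n, hn, fun ⟨m, hm⟩ => hup (mem_smul_of_sq_dvd_reducedNorm hdivp hOp huO ⟨m, ?_⟩)⟩
  rw [hn, hm]; push_cast; ring

omit hp hdivp hOp in
/-- `[O : u O] = p² · n²` (as `p`-part: exactly `p²`) for a uniformiser `u`, `nrd u = p n`. [folklore] -/
theorem relIndex_uniformiser_smul (hO : IsZOrder O) {u : Bˣ} {n : ℤ}
    (hn : reducedNorm ℚ B (u : B) = p * n) (huO : (u : B) ∈ O) :
    (u • O).toAddSubgroup.relIndex O.toAddSubgroup = p ^ 2 * n.natAbs ^ 2 := by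
  rw [relIndex_units_smul_eq_natAbs_sq hO huO (N := p * n) (by rw [hn]; push_cast; ring),
    Int.natAbs_mul, Int.natAbs_natCast, mul_pow]

/-- **`[O : u O + p O] ∣ p²`**: the index of `Q = u O + p O` divides `[O : u O] = p² n²` and
`[O : p O] = p⁴`, whose gcd is `p²` (`p ∤ n`). [cite: VignerasLNM800, Ch. II §1 Cor. 1.7] -/
theorem relIndex_span_uniformiser_dvd (hO : IsZOrder O) {u : Bˣ} (hu : (u : B) ∈ normPrimeIdeal O p)
    (hup : (u : B) ∉ (p : ℤ) • O) :
    (u • O ⊔ (p : ℤ) • O).toAddSubgroup.relIndex O.toAddSubgroup ∣ p ^ 2 := by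
  obtain ⟨n, hn, hpn⟩ := exists_reducedNorm_uniformiser hdivp hOp hO hu hup
  have huO : (u : B) ∈ O := normPrimeIdeal_le O p hu
  set Q := u • O ⊔ (p : ℤ) • O with hQ
  have hQO : Q ≤ O := sup_le (units_smul_le_of_mem hO huO) (Submodule.smul_le_self_of_tower _ O)
  have h1 : Q.toAddSubgroup.relIndex O.toAddSubgroup ∣ p ^ 2 * n.natAbs ^ 2 := by
    rw [← relIndex_uniformiser_smul hO hn huO]
    exact AddSubgroup.relIndex_dvd_of_le_left _ (Submodule.toAddSubgroup_mono le_sup_left)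
  have h2 : Q.toAddSubgroup.relIndex O.toAddSubgroup ∣ p ^ 4 := by
    rw [← relIndex_natCast_smul_eq_pow_four hO.isFullLattice hp.out.ne_zero]
    exact AddSubgroup.relIndex_dvd_of_le_left _ (Submodule.toAddSubgroup_mono le_sup_right)
  have hcop : Nat.Coprime (n.natAbs ^ 2) (p ^ 2) := by
    refine Nat.Coprime.pow _ _ ?_
    rw [Nat.coprime_comm, Nat.Prime.coprime_iff_not_dvd hp.out]
    exact fun h => hpn (Int.natCast_dvd.mpr h)
  have hg : Nat.gcd (p ^ 2 * n.natAbs ^ 2) (p ^ 4) = p ^ 2 := by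
    rw [show p ^ 4 = p ^ 2 * p ^ 2 by ring, Nat.gcd_mul_left, hcop.gcd_eq_one, mul_one]
  rw [← hg]
  exact Nat.dvd_gcd h1 h2

omit hp hdivp hOp in
/-- `u O + p O ⊆ P`. [folklore] -/
theorem span_uniformiser_le (hO : IsZOrder O) {u : Bˣ} (hu : (u : B) ∈ normPrimeIdeal O p) :
    u • O ⊔ (p : ℤ) • O ≤ normPrimeIdeal O p := by
  refine sup_le (fun x hx => ?_) (smul_le_normPrimeIdeal hO)
  obtain ⟨y, hy, rfl⟩ := (Submodule.mem_smul_pointwise_iff_exists x u O).mp hx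
  exact mul_mem_normPrimeIdeal_right hO hy hu

/-- **`[O : P] ∣ p²`** (in particular `P ≠ p O`). [cite: VignerasLNM800, Ch. II §1 Cor. 1.7] -/
theorem relIndex_normPrimeIdeal_dvd (hO : IsZOrder O) :
    (normPrimeIdeal O p).toAddSubgroup.relIndex O.toAddSubgroup ∣ p ^ 2 := by
  obtain ⟨u, hu, hup⟩ := exists_uniformiser hdivp hO
  exact (AddSubgroup.relIndex_dvd_of_le_left _
    (Submodule.toAddSubgroup_mono (span_uniformiser_le hO hu))).trans
    (relIndex_span_uniformiser_dvd hdivp hOp hO hu hup)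

/-- **`[O : P] ≥ [u O + p O : p O]`**: left multiplication by the uniformiser `u` kills `P`
modulo `p O` (`u P ⊆ P² ⊆ p O`), so `[O : P] ≥ [O : {x ∈ O : u x ∈ p O}] = [u O : u O ∩ p O]
= [u O + p O : p O]`. [cite: VignerasLNM800, Ch. II §1 Cor. 1.7] -/
theorem relIndex_smul_sup_le_relIndex_normPrimeIdeal (hO : IsZOrder O) {u : Bˣ}
    (hu : (u : B) ∈ normPrimeIdeal O p) :
    ((p : ℤ) • O).toAddSubgroup.relIndex (u • O ⊔ (p : ℤ) • O).toAddSubgroup ≤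
      (normPrimeIdeal O p).toAddSubgroup.relIndex O.toAddSubgroup := by
  -- `K = {x ∈ O : u x ∈ p O} ⊇ P`
  set K : Submodule ℤ B := O ⊓ u⁻¹ • ((p : ℤ) • O) with hK
  have hPK : normPrimeIdeal O p ≤ K := fun x hx => by
    refine Submodule.mem_inf.mpr ⟨normPrimeIdeal_le O p hx, ?_⟩
    rw [mem_units_smul_submodule_iff, inv_inv, Units.smul_def, smul_eq_mul]
    exact mul_mem_smul_of_mem_normPrimeIdeal hdivp hOp hO hu hx
  have hKO : K ≤ O := inf_le_left
  -- `[O : P] = [O : K] [K : P] ≥ [O : K]`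
  have hmul := AddSubgroup.relIndex_mul_relIndex (normPrimeIdeal O p).toAddSubgroup
    K.toAddSubgroup O.toAddSubgroup (Submodule.toAddSubgroup_mono hPK)
    (Submodule.toAddSubgroup_mono hKO)
  -- `[O : K] = [u O : u K] = [u O : u O ∩ p O] = [u O + p O : p O]`
  have huK : u • K = u • O ⊓ (p : ℤ) • O := by rw [hK, units_smul_inf, smul_inv_smul]
  have hOK : K.toAddSubgroup.relIndex O.toAddSubgroup =
      ((p : ℤ) • O).toAddSubgroup.relIndex (u • O ⊔ (p : ℤ) • O).toAddSubgroup := by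
    have hinf : (u • O ⊓ (p : ℤ) • O).toAddSubgroup =
        ((p : ℤ) • O).toAddSubgroup ⊓ (u • O).toAddSubgroup :=
      AddSubgroup.ext fun _ => by
        simp only [Submodule.mem_toAddSubgroup, Submodule.mem_inf, AddSubgroup.mem_inf, and_comm]
    rw [← relIndex_units_smul u K O, huK, hinf, AddSubgroup.inf_relIndex_right,
      Submodule.sup_toAddSubgroup, AddSubgroup.relIndex_sup_right]
  rw [← hOK, ← hmul]
  refine Nat.le_mul_of_pos_left _ (Nat.pos_of_ne_zero fun h0 => ?_)
  -- `[K : P] ≠ 0`: `P ⊇ p O` and `[K : p O] ∣ [O : p O] = p⁴`… more precisely `[K : pO] ≠ 0`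
  have h1 : ((p : ℤ) • O).toAddSubgroup.relIndex K.toAddSubgroup ≠ 0 := fun h1 => by
    have h4 : ((p : ℤ) • O).toAddSubgroup.relIndex O.toAddSubgroup ≠ 0 := by
      rw [relIndex_natCast_smul_eq_pow_four hO.isFullLattice hp.out.ne_zero]
      exact pow_ne_zero 4 hp.out.ne_zero
    exact h4 (AddSubgroup.relIndex_eq_zero_of_le_right (Submodule.toAddSubgroup_mono hKO) h1)
  refine h1 (Nat.eq_zero_of_zero_dvd ?_)
  rw [← h0]
  exact AddSubgroup.relIndex_dvd_of_le_left _
    (Submodule.toAddSubgroup_mono (smul_le_normPrimeIdeal hO))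

/-- **`[O : P] = p²`**: the residue ring `O / P` has `p²` elements (`f = 2`; Vignéras II §1
Cor. 1.7). From `[O : P] ∣ p²` and `[O : P] ≥ [u O + p O : p O] = p⁴ / [O : u O + p O] ≥ p²`. [cite: VignerasLNM800, Ch. II §1 Cor. 1.7] -/
theorem relIndex_normPrimeIdeal (hO : IsZOrder O) :
    (normPrimeIdeal O p).toAddSubgroup.relIndex O.toAddSubgroup = p ^ 2 := by
  obtain ⟨u, hu, hup⟩ := exists_uniformiser hdivp hO
  have hdvdP := relIndex_normPrimeIdeal_dvd hdivp hOp hO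
  have hdvdQ := relIndex_span_uniformiser_dvd hdivp hOp hO hu hup
  have hle := relIndex_smul_sup_le_relIndex_normPrimeIdeal hdivp hOp hO hu
  have huO : (u : B) ∈ O := normPrimeIdeal_le O p hu
  -- `[Q : pO] [O : Q] = [O : pO] = p⁴`
  have hmul := AddSubgroup.relIndex_mul_relIndex ((p : ℤ) • O).toAddSubgroup
    (u • O ⊔ (p : ℤ) • O).toAddSubgroup O.toAddSubgroup (Submodule.toAddSubgroup_mono le_sup_right)
    (Submodule.toAddSubgroup_mono (sup_le (units_smul_le_of_mem hO huO)
      (Submodule.smul_le_self_of_tower _ O)))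
  rw [relIndex_natCast_smul_eq_pow_four hO.isFullLattice hp.out.ne_zero] at hmul
  have hp2 : 0 < p ^ 2 := pow_pos hp.out.pos 2
  refine le_antisymm (Nat.le_of_dvd hp2 hdvdP) ?_
  -- `[Q : pO] ≥ p²`
  have hQ : p ^ 2 ≤ ((p : ℤ) • O).toAddSubgroup.relIndex (u • O ⊔ (p : ℤ) • O).toAddSubgroup := by
    have hOQ := Nat.le_of_dvd hp2 hdvdQ
    by_contra hlt
    rw [not_le] at hlt
    have : ((p : ℤ) • O).toAddSubgroup.relIndex (u • O ⊔ (p : ℤ) • O).toAddSubgroup *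
        (u • O ⊔ (p : ℤ) • O).toAddSubgroup.relIndex O.toAddSubgroup < p ^ 2 * p ^ 2 :=
      Nat.mul_lt_mul_of_lt_of_le hlt hOQ hp2
    rw [hmul] at this
    exact absurd this (by rw [← pow_add]; norm_num)
  exact hQ.trans hle

/-- **`P = u O + p O`** for every uniformiser `u ∈ P ∖ p O`. [cite: VignerasLNM800, Ch. II §1 Cor. 1.7] -/
theorem normPrimeIdeal_eq_sup (hO : IsZOrder O) {u : Bˣ} (hu : (u : B) ∈ normPrimeIdeal O p)
    (hup : (u : B) ∉ (p : ℤ) • O) : normPrimeIdeal O p = u • O ⊔ (p : ℤ) • O := by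
  have hQP := span_uniformiser_le hO hu (p := p)
  refine le_antisymm ?_ hQP
  have hmul := AddSubgroup.relIndex_mul_relIndex (u • O ⊔ (p : ℤ) • O).toAddSubgroup
    (normPrimeIdeal O p).toAddSubgroup O.toAddSubgroup (Submodule.toAddSubgroup_mono hQP)
    (Submodule.toAddSubgroup_mono (normPrimeIdeal_le O p))
  rw [relIndex_normPrimeIdeal hdivp hOp hO] at hmul
  have hdvd := relIndex_span_uniformiser_dvd hdivp hOp hO hu hup
  rw [← hmul] at hdvd
  have h1 : (u • O ⊔ (p : ℤ) • O).toAddSubgroup.relIndex (normPrimeIdeal O p).toAddSubgroup = 1 :=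
    Nat.dvd_one.mp (Nat.dvd_of_mul_dvd_mul_right (pow_pos hp.out.pos 2) (by rwa [one_mul]))
  exact fun x hx => (AddSubgroup.relIndex_eq_one.mp h1) hx

end Uniformiser

end IndexPart

/-! ## Part III. Locally at `p` -/

section LocalPart

/-! ### `p`-integrality helpers -/

section PIntegral

variable {p : ℕ} [hp : Fact p.Prime]

/-- `p ∤ den q ↔ 0 ≤ v_p(q)`. [folklore] -/
theorem not_dvd_den_iff_padicValRat_nonneg {q : ℚ} : ¬ p ∣ q.den ↔ 0 ≤ padicValRat p q := by
  refine ⟨fun h => ?_, not_dvd_den_of_padicValRat_nonneg⟩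
  rcases eq_or_ne q 0 with rfl | hq
  · simp
  rw [padicValRat_def, padicValNat.eq_zero_of_not_dvd h]
  simp

/-- A `p`-integral rational whose quotient by `p` is not `p`-integral is a `p`-adic unit: its
inverse is `p`-integral. [folklore] -/
theorem not_dvd_den_inv_of_dvd_den_div {q : ℚ} (hq : ¬ p ∣ q.den) (hqp : p ∣ (q / p).den) :
    ¬ p ∣ q⁻¹.den := by
  have hq0 : q ≠ 0 := by
    rintro rfl
    rw [zero_div, Rat.den_zero] at hqp
    exact hp.out.one_lt.ne' (Nat.dvd_one.mp hqp)
  rw [not_dvd_den_iff_padicValRat_nonneg] at hq ⊢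
  have hv : ¬ 0 ≤ padicValRat p (q / p) := fun h => (not_dvd_den_of_padicValRat_nonneg h) hqp
  rw [padicValRat.div hq0 (by exact_mod_cast hp.out.ne_zero), padicValRat.self hp.out.one_lt] at hv
  rw [padicValRat.inv]
  omega

end PIntegral

variable {B : Type u} [Ring B] [Algebra ℚ B] [IsQuaternionAlgebra ℚ B]
variable {O : Submodule ℤ B} {p : ℕ} [hp : Fact p.Prime]

/-! ### Local right modules -/

section LocalModule

omit [IsQuaternionAlgebra ℚ B] hp in
/-- The localisation of a right `O`-module is a right `O_(p)`-module. [folklore] -/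
theorem mul_mem_localAt_of_mul_mem {M : Submodule ℤ B} (hM : ∀ m ∈ M, ∀ o ∈ O, m * o ∈ M)
    {x o : B} (hx : x ∈ localAt p M) (ho : o ∈ localAt p O) : x * o ∈ localAt p M := by
  have h : localAt p M * localAt p O ≤ localAt p M := by
    rw [localAt_mul_localAt_eq]
    exact localAt_mono p (Submodule.mul_le.mpr hM)
  exact h (Submodule.mul_mem_mul hx ho)

omit [IsQuaternionAlgebra ℚ B] hp in
/-- `O_(p)` is stable under the standard involution (as `O` is). [folklore] -/
theorem standardInvolution_mem_localAt [IsQuaternionAlgebra ℚ B] (hO : IsZOrder O) {x : B}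
    (hx : x ∈ localAt p O) : standardInvolution ℚ B x ∈ localAt p O := by
  obtain ⟨m, hm0, hm, hmx⟩ := hx
  refine ⟨m, hm0, hm, ?_⟩
  have h := hO.toIsOrder.standardInvolution_mem hmx
  rwa [← Int.cast_smul_eq_zsmul ℚ, standardInvolution_smul, Int.cast_smul_eq_zsmul] at h

end LocalModule

/-! ### `P_(p)` described by norms; units of `O_(p)` -/

section Local

variable (hdivp : ∀ X : ScalarExtension ℚ ℚ_[p] B, X ≠ 0 → IsUnit X)
variable (hOp : ∀ x : B, x ∈ localAt p O ↔
  ¬ p ∣ (reducedNorm ℚ B x).den ∧ ¬ p ∣ (reducedTrace ℚ B x).den)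
include hdivp

/-- **`x ∈ P_(p) ↔ x ∈ O_(p) ∧ nrd x / p ∈ ℤ_(p)`** (i.e. `v_p(nrd x) ≥ 1`). [cite: VignerasLNM800, Ch. II §1 Lemme 1.5] -/
theorem mem_localAt_normPrimeIdeal_iff (hO : IsZOrder O) {x : B} :
    x ∈ localAt p (normPrimeIdeal O p) ↔
      x ∈ localAt p O ∧ ¬ p ∣ (reducedNorm ℚ B x / p).den := by
  have hpQ : (p : ℚ) ≠ 0 := by exact_mod_cast hp.out.ne_zero
  constructor
  · rintro ⟨m, hm0, hm, hmx⟩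
    rw [mem_normPrimeIdeal_iff hdivp hO] at hmx
    obtain ⟨hmxO, n, hn⟩ := hmx
    refine ⟨⟨m, hm0, hm, hmxO⟩, not_dvd_den_of_natCast_pow_mul_eq_intCast hm0 hm (k := 2) (N := n) ?_⟩
    rw [reducedNorm_zsmul, Int.cast_natCast] at hn
    rw [mul_div_assoc', hn]; field_simp
  · rintro ⟨⟨m, hm0, hm, hmx⟩, hden⟩
    refine ⟨m, hm0, hm, (mem_normPrimeIdeal_iff hdivp hO).mpr ⟨hmx, ?_⟩⟩
    obtain ⟨N, hN⟩ := hO.exists_int_reducedNorm hmx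
    rw [reducedNorm_zsmul, Int.cast_natCast] at hN
    -- `N / p = m² (nrd x / p)` is `p`-integral, hence `p ∣ N`
    have hNp : ¬ p ∣ ((N : ℚ) / p).den := by
      have : (N : ℚ) / p = ((m : ℚ) ^ 2) * (reducedNorm ℚ B x / p) := by rw [← hN]; ring
      rw [this]
      refine not_dvd_den_mul hp.out ?_ hden
      have h := not_dvd_den_intCast hp.out (((m ^ 2 : ℕ) : ℤ))
      rwa [Int.cast_natCast, Nat.cast_pow] at h
    obtain ⟨k, hk⟩ := Int.dvd_of_not_dvd_den_div hNp
    exact ⟨k, by rw [reducedNorm_zsmul, Int.cast_natCast, hN, hk]; push_cast; ring⟩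

omit hdivp in
/-- **Elements of `O_(p)` of `p`-unit norm are units of `O_(p)`**: if `x ∈ O_(p)` and
`nrd x / p ∉ ℤ_(p)` then `x` is a unit of `B` with `x⁻¹ = x̄ / nrd x ∈ O_(p)`. [cite: VignerasLNM800, Ch. II §1 Lemme 1.5] -/
theorem inv_mem_localAt_of_dvd_den (hO : IsZOrder O) (hdiv : ∀ x : B, x ≠ 0 → IsUnit x) {x : B}
    (hx : x ∈ localAt p O) (hnp : p ∣ (reducedNorm ℚ B x / p).den) :
    ∃ hx0 : x ≠ 0, (((hdiv x hx0).unit⁻¹ : Bˣ) : B) ∈ localAt p O := by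
  have hx0 : x ≠ 0 := by
    rintro rfl
    rw [reducedNorm_apply_zero, zero_div, Rat.den_zero] at hnp
    exact hp.out.one_lt.ne' (Nat.dvd_one.mp hnp)
  refine ⟨hx0, ?_⟩
  have hn := (hO.not_dvd_den_of_mem_localAt hx).1
  have hinv := not_dvd_den_inv_of_dvd_den_div hn hnp
  rw [units_val_inv_eq_smul_standardInvolution, IsUnit.unit_spec]
  exact rat_smul_mem_localAt (standardInvolution_mem_localAt hO hx) hinv

omit hdivp in
/-- **`O_(p)` is local with maximal ideal `P_(p)`** (module form): a right `O_(p)`-stable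
submodule `N ⊆ O_(p)` containing an element of `p`-unit norm is all of `O_(p)`. [cite: VignerasLNM800, Ch. II §1 Lemme 1.5] -/
theorem localAt_le_of_exists_unit (hO : IsZOrder O) (hdiv : ∀ x : B, x ≠ 0 → IsUnit x)
    {N : Submodule ℤ B} (hNO : N ≤ localAt p O)
    (hNmul : ∀ m ∈ N, ∀ o ∈ localAt p O, m * o ∈ N) {x : B} (hx : x ∈ N)
    (hnp : p ∣ (reducedNorm ℚ B x / p).den) : localAt p O ≤ N := by
  obtain ⟨hx0, hinv⟩ := inv_mem_localAt_of_dvd_den hO hdiv (hNO hx) hnp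
  have h1 : (1 : B) ∈ N := by
    have := hNmul x hx _ hinv
    have e : x * (((hdiv x hx0).unit⁻¹ : Bˣ) : B) = 1 := Units.mul_inv (hdiv x hx0).unit
    rwa [e] at this
  intro o ho
  simpa using hNmul 1 h1 o ho

include hOp

/-- `[O_(p) : P_(p)] = p²` (indices localise). [cite: VignerasLNM800, Ch. II §1 Cor. 1.7] -/
theorem relIndex_localAt_normPrimeIdeal (hO : IsZOrder O) :
    (localAt p (normPrimeIdeal O p)).toAddSubgroup.relIndex (localAt p O).toAddSubgroup = p ^ 2 := by
  rw [relIndex_localAt O (normPrimeIdeal O p) (normPrimeIdeal_le O p)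
    (by rw [relIndex_normPrimeIdeal hdivp hOp hO]; exact pow_ne_zero 2 hp.out.ne_zero),
    relIndex_normPrimeIdeal hdivp hOp hO, Nat.Prime.factorization_pow hp.out, Finsupp.single_eq_same]

/-- **Uniqueness of the ideal of index `p²`**: a right `O_(p)`-stable submodule
`N ⊆ O_(p)` with `[O_(p) : N] = p²` is `P_(p)` (Vignéras II §1: the integral ideals of `O_p` are
the powers `Pⁿ`; the one of norm `p` is `P`). [cite: VignerasLNM800, Ch. II §1 Lemme 1.5 and Cor. 1.7] -/
theorem eq_localAt_normPrimeIdeal_of_relIndex_eq_sq (hO : IsZOrder O) {N : Submodule ℤ B}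
    (hNO : N ≤ localAt p O)
    (hNmul : ∀ m ∈ N, ∀ o ∈ localAt p O, m * o ∈ N)
    (hidx : N.toAddSubgroup.relIndex (localAt p O).toAddSubgroup = p ^ 2) :
    N = localAt p (normPrimeIdeal O p) := by
  have hdiv : ∀ x : B, x ≠ 0 → IsUnit x := forall_isUnit_of_padic_division hdivp
  -- every element of `N` has norm divisible by `p`, else `N = O_(p)` (index `1 ≠ p²`)
  have hNP : N ≤ localAt p (normPrimeIdeal O p) := fun x hx => by
    rw [mem_localAt_normPrimeIdeal_iff hdivp hO]
    refine ⟨hNO hx, fun hnp => ?_⟩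
    have hle := localAt_le_of_exists_unit hO hdiv hNO hNmul hx hnp
    have h1 : N.toAddSubgroup.relIndex (localAt p O).toAddSubgroup = 1 :=
      AddSubgroup.relIndex_eq_one.mpr (Submodule.toAddSubgroup_mono hle)
    rw [h1] at hidx
    have : 1 < p ^ 2 := Nat.one_lt_pow two_ne_zero hp.out.one_lt
    omega
  -- compare indices: `[O_(p) : P_(p)] = p²`
  have hPidx := relIndex_localAt_normPrimeIdeal hdivp hOp hO
  have hmul := AddSubgroup.relIndex_mul_relIndex N.toAddSubgroup
    (localAt p (normPrimeIdeal O p)).toAddSubgroup (localAt p O).toAddSubgroup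
    (Submodule.toAddSubgroup_mono hNP)
    (Submodule.toAddSubgroup_mono (localAt_mono p (normPrimeIdeal_le O p)))
  rw [hidx, hPidx] at hmul
  have h1 : N.toAddSubgroup.relIndex (localAt p (normPrimeIdeal O p)).toAddSubgroup = 1 := by
    have hp2 : 0 < p ^ 2 := pow_pos hp.out.pos 2
    exact Nat.eq_of_mul_eq_mul_right hp2 (hmul.trans (one_mul _).symm)
  exact le_antisymm hNP fun x hx => (AddSubgroup.relIndex_eq_one.mp h1) hx

/-! ### `P_(p) = u O_(p)` and `(P P)_(p) = p O_(p)` -/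

/-- `p ∈ u O_(p)` for a uniformiser `u` (`nrd u = p n`, `p ∤ n`): `p = u · (ū / n)`. [folklore] -/
theorem natCast_mem_uniformiser_smul_localAt (hO : IsZOrder O) {u : Bˣ}
    (hu : (u : B) ∈ normPrimeIdeal O p) (hup : (u : B) ∉ (p : ℤ) • O) :
    (p : B) ∈ u • localAt p O := by
  obtain ⟨n, hn, hpn⟩ := exists_reducedNorm_uniformiser hdivp hOp hO hu hup
  have huO : (u : B) ∈ O := normPrimeIdeal_le O p hu
  have hn0 : (n : ℚ) ≠ 0 := by
    rintro h
    have : n = 0 := by exact_mod_cast h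
    exact hpn (this ▸ dvd_zero _)
  have hpQ : (p : ℚ) ≠ 0 := by exact_mod_cast hp.out.ne_zero
  rw [mem_units_smul_iff_mul_mem, units_val_inv_eq_smul_standardInvolution, hn, smul_mul_assoc]
  -- `(p n)⁻¹ • (ū p) = n⁻¹ • ū`
  have : ((p : ℚ) * n)⁻¹ • (standardInvolution ℚ B (u : B) * (p : B)) =
      (n : ℚ)⁻¹ • standardInvolution ℚ B (u : B) := by
    rw [show (p : B) = algebraMap ℚ B (p : ℚ) by simp, ← Algebra.commutes, ← Algebra.smul_def,
      smul_smul]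
    congr 1
    field_simp
  rw [this]
  refine rat_smul_mem_localAt (le_localAt p O (hO.toIsOrder.standardInvolution_mem huO)) ?_
  rw [Rat.inv_intCast_den, if_neg (by rintro rfl; exact hpn (dvd_zero _))]
  exact fun h => hpn (Int.natAbs_dvd.mp (Int.natCast_dvd.mpr h) |> Int.dvd_natAbs.mp)

/-- **`P_(p) = u O_(p)`**: the prime above a ramified prime is locally principal, generated by
any uniformiser (Vignéras II §1 Cor. 1.7: `P = O u`). [cite: VignerasLNM800, Ch. II §1 Cor. 1.7] -/
theorem localAt_normPrimeIdeal_eq_units_smul (hO : IsZOrder O) {u : Bˣ}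
    (hu : (u : B) ∈ normPrimeIdeal O p) (hup : (u : B) ∉ (p : ℤ) • O) :
    localAt p (normPrimeIdeal O p) = u • localAt p O := by
  rw [normPrimeIdeal_eq_sup hdivp hOp hO hu hup, localAt_sup, localAt_units_smul]
  refine le_antisymm (sup_le le_rfl fun z hz => ?_) le_sup_left
  -- `p O_(p)`-type elements: `m z = p y` with `y ∈ O`
  obtain ⟨m, hm0, hm, hmz⟩ := hz
  obtain ⟨y, hy, hmy⟩ := (Submodule.mem_smul_pointwise_iff_exists _ _ O).mp hmz
  have hpu := natCast_mem_uniformiser_smul_localAt hdivp hOp hO hu hup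
  -- `m z = p y ∈ u O_(p)`, and `u O_(p)` is `p`-local
  have hmz' : ((m : ℤ) • z) ∈ u • localAt p O := by
    rw [← hmy, zsmul_eq_mul, Int.cast_natCast]
    rw [mem_units_smul_iff_mul_mem] at hpu ⊢
    rw [← mul_assoc]
    exact mul_mem_localAt hO.mul_mem p hpu (le_localAt p O hy)
  rw [← localAt_units_smul] at hmz' ⊢
  have h := mem_localAt_of_smul_mem hm0 hm hmz'
  rwa [localAt_localAt] at h

/-- **`p ∈ (P P)_(p)`**: `p = n⁻¹ · u ū` with `u, ū ∈ P`. [cite: VignerasLNM800, Ch. II §1 Cor. 1.7] -/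
theorem natCast_mem_localAt_normPrimeIdeal_mul (hO : IsZOrder O) :
    (p : B) ∈ localAt p (normPrimeIdeal O p * normPrimeIdeal O p) := by
  obtain ⟨u, hu, hup⟩ := exists_uniformiser hdivp hO
  obtain ⟨n, hn, hpn⟩ := exists_reducedNorm_uniformiser hdivp hOp hO hu hup
  have huO : (u : B) ∈ O := normPrimeIdeal_le O p hu
  have hubar : standardInvolution ℚ B (u : B) ∈ normPrimeIdeal O p := by
    rw [mem_normPrimeIdeal_iff hdivp hO]
    exact ⟨hO.toIsOrder.standardInvolution_mem huO, n, by rw [reducedNorm_standardInvolution, hn]⟩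
  have hprod : (u : B) * standardInvolution ℚ B (u : B) = algebraMap ℚ B ((p : ℚ) * n) := by
    rw [mul_standardInvolution_holds ℚ B, hn]
  have hn0 : (n : ℚ) ≠ 0 := by
    rintro h
    have : n = 0 := by exact_mod_cast h
    exact hpn (this ▸ dvd_zero _)
  have : (p : B) = (n : ℚ)⁻¹ • ((u : B) * standardInvolution ℚ B (u : B)) := by
    rw [hprod, Algebra.algebraMap_eq_smul_one, smul_smul]
    have : (n : ℚ)⁻¹ * ((p : ℚ) * n) = p := by field_simp
    rw [this, Nat.cast_smul_eq_nsmul, nsmul_eq_mul, mul_one]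
  rw [this]
  refine rat_smul_mem_localAt (le_localAt p _ (Submodule.mul_mem_mul hu hubar)) ?_
  rw [Rat.inv_intCast_den, if_neg (by rintro rfl; exact hpn (dvd_zero _))]
  exact fun h => hpn (Int.natAbs_dvd.mp (Int.natCast_dvd.mpr h) |> Int.dvd_natAbs.mp)

/-- **`(P P)_(p) = p O_(p)`** (Vignéras II §1 Cor. 1.7: `P² = O p`, ramification index
`e = 2`). [cite: VignerasLNM800, Ch. II §1 Cor. 1.7] -/
theorem localAt_normPrimeIdeal_mul (hO : IsZOrder O) :
    localAt p (normPrimeIdeal O p * normPrimeIdeal O p) = localAt p ((p : ℤ) • O) := by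
  refine le_antisymm (localAt_mono p (normPrimeIdeal_mul_le hdivp hOp hO)) ?_
  rintro z ⟨m, hm0, hm, hmz⟩
  obtain ⟨y, hy, hmy⟩ := (Submodule.mem_smul_pointwise_iff_exists _ _ O).mp hmz
  have hPP : ∀ a ∈ normPrimeIdeal O p * normPrimeIdeal O p, ∀ o ∈ O,
      a * o ∈ normPrimeIdeal O p * normPrimeIdeal O p := fun a ha o ho => by
    refine Submodule.mul_induction_on ha (fun x hx y hy => ?_) (fun b c hb hc => ?_)
    · rw [mul_assoc]; exact Submodule.mul_mem_mul hx (mul_mem_normPrimeIdeal_right hO ho hy)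
    · rw [add_mul]; exact add_mem hb hc
  have hmz' : ((m : ℤ) • z) ∈ localAt p (normPrimeIdeal O p * normPrimeIdeal O p) := by
    rw [← hmy, zsmul_eq_mul, Int.cast_natCast]
    exact mul_mem_localAt_of_mul_mem hPP (natCast_mem_localAt_normPrimeIdeal_mul hdivp hOp hO)
      (le_localAt p O hy)
  have h := mem_localAt_of_smul_mem hm0 hm hmz'
  rwa [localAt_localAt] at h

end Local

end LocalPart

end Literature.NumberTheory.Automorphic

end
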